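import Mathlib
import HarnessLib
import HarnessLib.Audit
import Summits.QuantumAdvantage.Statement
import Literature.Computability.Cryptography.ClassBQP
import Literature.Computability.Complexity.Randomized
import HarnessLib.Audit.Status.Attr

/-!
Route: LinnikCubicClassGroups

DORMANT since 2026-08-26T15:00:32Z (reconciler: no traction for 6.5 d (last activity item-evidence-added at 2026-08-20T02:36:12Z); parked, not closed — `ledger route dormant route-QuantumAdvantage-LinnikCubicClassGroups --off` to reacti) — unstaffed, not closed; items shared with open routes are served there. `ledger route dormant <id> --off` reactivates.

# Route LinnikCubicClassGroups — random large factor bases — Linnik–Stark put cubic class groups in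
BQP with no GRH and no Siegel hypothesis

It suffices to show X = PureCubicClassNumberHard (hypothesis-type, rank 0): no probabilistic
polynomial-time algorithm outputs, on every
non-cube m (m = decodeNat x), the 2|x|+8 low bits of the class number h(ℚ(∛m)). Realises idea card
linnik-lights-the-class-group-v2 AS
CORRECTED here: the card's mechanism (O(log D) RANDOM degree-one primes of norm ≤ D^C as the factor
base of the Hallgren/Biasse–Song
relation-lattice HSP; unconditional Linnik-type counts replace Bach's GRH bound) is load-bearing
exactly for fields WITHOUT A QUADRATIC
SUBFIELD, where Stark's theorem forbids a Landau–Siegel zero of ζ_K itself; at n = 2 (the card's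
L_h) the exceptional character may be the
trivial class-group character (Siegel zero of χ_d) and every class is dark — that case is
DarkClassGroups' hypothesis (i), not removed.
The quantum half (cruxes DegreeOnePrimesEscape, PureCubicClassGroupFBQP + support
RandomSamplesGenerate) is a THEOREM-TARGET with no GRH and
no Siegel hypothesis: x ↦ h(ℚ(∛ decodeNat x)) ∈ FBQP; with X and BitwiseSearchToDecision the bit
language of h witnesses ∃ L ∈ BQP, L ∉ BPP.
Lean: `¬ ∃ A : Literature.Computability.Complexity.RandAlg (List Bool) (List Bool), A.IsPolyTime id
id ∧ ∀ (x : List Bool) (K : Type) [Field K] [NumberField K], Module.finrank ℚ K = 3 → (∀ r : ℕ, r ^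
3 ≠ Computability.decodeNat x) → (∃ α : K, α ^ 3 = (Computability.decodeNat x : K)) → (2 : ℝ) / 3 ≤
A.pr id x {List.ofFn (fun i : Fin (2 * x.length + 8) => (NumberField.classNumber K).testBit i.val)}`

## Assembly
Pure logic (sorry-free in Sketch.lean and glue.lean; axioms propext / Classical.choice /
Quot.sound): PureCubicClassGroupFBQP applied to
DegreeOnePrimesEscape gives f ∈ FBQP of output length 2|x|+8 agreeing with the class-number bits on
valid inputs; if the
summit failed then BQP ⊆ BPP (classically), BitwiseSearchToDecision (p = 2X+8) gives a PPT algorithm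
A with Pr[A(x) = f x] ≥ 2/3 for all x, hence
Pr[A(x) = bits of h(K)] ≥ 2/3 on every valid (x, K) — contradicting PureCubicClassNumberHard.
Deciding theorem
`closes (hT : PureCubicClassNumberHard) (h2 : DegreeOnePrimesEscape) (h4 : PureCubicClassGroupFBQP)
(h5 : BitwiseSearchToDecision) : QuantumAdvantage`; the Assembly item is restated over the same four
items (route-repair);
RandomSamplesGenerate is the foreseen probabilistic lemma inside the proof of
PureCubicClassGroupFBQP (support, off the deciding path).

Rationale: WHY THIS LINE. Every printed "class group in BQP" theorem (Hallgren2005, BiasseSong2015,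
doi:10.1145/2591796.2591860, arXiv:2510.02280 Cor. 1) assumes GRH at one place — Bach1990's bound
making prime ideals of norm ≤ 12 log²|D_K| generate Cl(K) — because it copies the classical
index-calculus template, where the factor base must be SMALL (smoothness) and h must be VERIFIED
(Euler product); a bounded-error Fourier-sampling algorithm needs neither, so its factor base may
consist of T = O(log D_K) random degree-one primes of norm D_K^(C(n)) (card
linnik-lights-the-class-group-v2). Imported from analytic number theory: ThornerZaman2019 Thm 1.4
(READ, arXiv:1803.02823 p. 3: K-uniform Chebotarev for the Hilbert class field, π_C(x) = (1/h)(Li x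
− χ₁(C) Li x^β₁)(1+o(1)) for x ≥ (D_K n^n)^c₁, log-free zero density + Deuring–Heilbronn, after
LagariasMontgomeryOdlyzko1979 and Weiss 1983) and Stark1974 (MurtyMurty1997 Cor. 6.2, READ: in 1 −
1/(4 log d_N) ≤ σ < 1 only a real linear character cutting out a quadratic subfield can vanish),
plus a counting lemma on finite groups (coset of the index-2 kernel; union bound over maximal
subgroups). The correction to the card: χ₁ may be TRIVIAL (ζ_K's own Siegel zero: all classes
depleted, degree-one primes exponentially rare at every polynomial height), which Stark excludes
precisely when K has no quadratic subfield — so the line is unconditional in every ODD degree and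
the thesis moves from real quadratic to PURE CUBIC fields. What it does that prior routes do not:
DarkClassGroups (imaginary quadratic) needs NoSiegelZerosOddQuadratic;
ArithStatLadder/CentralFactorial carry GRH; here the quantum half has NO unproved arithmetic
hypothesis, and the classical half is a factoring-independent class-number hardness assumption
(Cohen1993 §6.5: Buchmann's L(1/2) algorithm is itself GRH-conditional). STATE 2026-08-16
(judge-repair): both analytic inputs are IN TREE — TZ2019 Thm 1.4 for the Hilbert class field is the
vendored named fact
`Literature.NumberTheory.LFunctions.NumberField.ThornerZaman2019_classPNT_hilbertClassField` (class
group L-functions ARE expressible: `classGroupLFunction`, `primeIdealClassCount`,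
`offsetLogIntegral`) and Stark's consequence is PROVED
(`…Stark1974_dedekindZeta_ne_zero_of_noQuadraticSubfield_holds`,
StarkNoQuadraticSubfieldProofs.lean), so DegreeOnePrimesEscape is CONDITIONALLY PROVED
(kernel-checked, standard axioms) and its remaining debt is Lean-formal; and the quantum half runs
at unit rank ONE (K ∋ ∛m has signature (1,1)): Buchmann–Williams infrastructure + a single HSP over
ℤ^T × ℝ (Hallgren2005 at r = 1) — the EHKS14 continuous HSP is not needed.

RANKED CRUXES. #0 PureCubicClassNumberHard (target) — X (hypothesis-type, never staffed for proof):
no PPT algorithm A outputs with probability ≥ 2/3, for every bit string x with m = decodeNat x not a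
perfect cube and every number field K of degree 3 containing a cube root of m (all ≅ ℚ(∛m)), the
list of the 2|x|+8 low bits of NumberField.classNumber K. [difficulty: open-problem] (why it might
fail: False iff a classical PPT algorithm computes h(ℚ(∛m)) for all m (state of the art: Buchmann
L(1/2) under GRH, exponential unconditionally); true ⇒ FBPP misses a PSPACE function ⇒ P ≠ PSPACE:
unprovable today, hypothesis-type.) [Cohen1993 §6.5, BiasseSong2015, Hallgren2005, Bach1990,
Literature.Barriers.QuantumAdvantage.SeparationPrerequisites] #2 DegreeOnePrimesEscape (crux) — card
K1 corrected (Linnik–Stark escape count). For every n there is C = C(n) such that for every number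
field K of degree n with NO quadratic subfield, every x ≥ |D_K|^C and every proper subgroup M of
Cl(O_K): π(x) ≤ 8 · #{P prime of O_K : N(P) prime, N(P) ≤ x, [P] ∉ M}. Proof on paper: TZ2019 Thm
1.4 with F = K, L = Hilbert class field, H = G = Cl(K), Q = 1; Stark: ζ_K(σ) ≠ 0 on [1 −
1/(4·n!·log|D_K|), 1) since log d_N ≤ n! log d_K and K ⊉ quadratic field, so a TZ-exceptional χ₁ is
either absent, or trivial with λ₁ ≥ 1/(4 n!) (depletion ≤ e^(−2) once C ≥ 8 n!), or a nontrivial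
quadratic character with kernel K₁ of index 2 — then classes outside M ∪ K₁ number ≥ h/4 and each
holds ≥ (1−o(1)) Li(x)/h primes (sign −χ₁(C) = +1); degree ≥ 2 primes are O(n√x). [difficulty: L]
(why it might fail: conditionally PROVED ×2 — `OneSidedShadows.degreeOnePrimesEscape_of_TZ_Stark`
(Cruxes/DegreeOnePrimesEscape/IdeatorSketchR1I3.lean) and `cruxFromTZStark_holds`
(Lines/subgroup-orthogonality-escape.lean), TZ fact → crux, rc 0, standard axioms, Stark input
discharged in Literature — so it is false only with the printed Hilbert-class-field PNT; the live
risk is FORMAL: the ∀ n statement needs K-uniform log-free zero density in every degree (tree: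
`logFreeDensity_classGroup` n ≤ 4, `logFreeDensity_dedekindZeta₁` n ≤ 2; Weiss1983 Thm 4.3 / TZ2019
Thm 3.2 in general) plus a residue lower bound, while the route consumes only n = 3 (cdisprove
`route_needs_only_three`; `stub_generation` uses `hEsc 3`). STATUS: two line leads —
dedekind-s3-collision (stubs 1–4 LANDED; one TZ-side stub left) and subgroup-orthogonality-escape v4
(density stubs X1/X2 + residue R + Stark S, composition proved).) [ThornerZaman2019 Thm 1.4 + Thm
3.2 (arXiv:1803.02823), Stark1974 / MurtyMurty1997 Cor 6.2 (PROVED in tree), Weiss1983 Thm 4.3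
(doi:10.1515/crll.1983.338.56), arXiv:2412.01802 Cor 4 (Thorner–Zhang 2024),
LagariasMontgomeryOdlyzko1979, KadiriNgWong2019] #3 PureCubicClassGroupFBQP (crux) — card K3 at n =
3 (theorem-target, the quantum half). Assuming DegreeOnePrimesEscape (and using the provable-now
lemma RandomSamplesGenerate), there is f ∈ FBQP with |f x| = 2|x|+8 and f x = the low bits of h(K)
for every degree-3 number field K containing a cube root of the non-cube m = decodeNat x. Algorithm:
Shor-factor m = ab² and write Dedekind's integral basis of ℚ(∛m) (Cohen1993 §6.4); draw T = O(log
|D_K|) uniform random primes q ≤ |D_K|^C(3), factor qO_K, keep a random degree-one factor (escape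
probability ≥ 1/(8·9) per draw for every maximal subgroup by DegreeOnePrimesEscape and #{deg-1
primes ≤ x} ≤ 3π(x)); by RandomSamplesGenerate (#subgroups of Cl ≤ h^(log₂ h)) the T primes generate
Cl(K) w.p. ≥ 1 − 1/|D_K|; K has signature (1,1), unit rank ONE: compute the regulator R by period
finding on the Voronoi / Buchmann–Williams cycle of reduced divisors (six-gap: ≤ 6 relative minima
per dyadic real range, `stub_packing` LANDED; circumference = R, `stub_regulatorPeriod` LANDED;
BuchmannWilliams1988), then ONE Fourier-sampling family over ℤ_M^T × ℤ_q on the cycles of ∏ 𝔭ᵢ^{eᵢ}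
gives the order of ⟨[𝔭ᵢ]⟩ = Cl(K) from det Λ = h·R (Hallgren2005 §4–5 at r = 1; no EHKS14 continuous
HSP, no smoothness, no verification); output 2|x|+8 bits (h ≪ √|D_K| log²|D_K| < 2^(2|x|+8)). [deps:
DegreeOnePrimesEscape] [difficulty: XL] (why it might fail: with T = O(log² D) generators of norm ≤
D^C the r = 1 pipeline must stay polynomial WITHOUT small norms: pseudo-injectivity of the
discretised distance map (bad-point fraction O(1/N) via the six-gap), exponent box / wrap-around for
the ℤ^T part, O(log D)-bit R and q, and worst-case success ≥ 2/3 on EVERY x (generation failure ≤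
1/8 + HSP failure ≤ 1/16); a hidden small-norm/GRH/heuristic step voids 'unconditional'. Refuter
pass REQUESTED on exactly this (evidence PRECISION-AUDIT-REQUEST.md on stmt-QuantumAdvantage-11544,
six-point checklist). STATUS: line arakelov-giant-step-cycle, S1 S2 S4a S4b LANDED, hardest open
stub `stub_subgroupOrder` (S5b).) [Hallgren2005 §4–5, Hallgren2007 (J.ACM 54(1),
doi:10.1145/1206035.1206039), SchmidtVollmer2005 (doi:10.1145/1060590.1060661), BuchmannWilliams1988
(doi:10.2307/2008625), BiasseSong2015, doi:10.1145/2591796.2591860 (EHKS14, r > 1 only),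
CheungMosca2001, Cohen1993 §6.4, arXiv:2510.02280,
Literature.Computability.Cryptography.factoring_mem_FBQP_holds] #9 RandomSamplesGenerate (support,
PROVED 2026-08-15 `…Theorems.LinnikCubicClassGroups.randomSamplesGenerate_proof`) — card P1/K2
abstracted: G a finite group, s : Ω → G a finite sample space such that for every maximal subgroup M
at least δ|Ω| sample points fall outside M (0 ≤ δ ≤ 1); then among the |Ω|^T sequences of T samples
at most #Sub(G)·(1−δ)^T·|Ω|^T generate a proper subgroup (a proper subgroup of a finite group lies
in a coatom; union bound over coatoms ≤ #subgroups; for the class group #Sub ≤ h^(log₂ h), so T =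
O((log² h + log(1/ε))/δ) suffices). [difficulty: provable-now] [CheungMosca2001 §3, Hallgren2005 §4,
Mathlib IsCoatom / Subgroup.closure (folklore union bound)] #9 BitwiseSearchToDecision (support,
PROVED 2026-08-16 `…Theorems.LinnikCubicClassGroups.BitwiseSearchToDecision_proof`) — bitwise
search-to-decision: an FBQP function of exactly polynomial output length is PPT-computable if BQP ⊆
BPP. It is the shared item stmt-QuantumAdvantage-0235 of routes Shor/DarkClassGroups with the
abbreviation `IsPPT A id` unfolded to `A.IsPolyTime id id` (route-repair rev 2: `rfl`-equal,
DefEqCheck.lean rc 0 — a proof of either decl proves the other verbatim), so that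
Cryptography/OneWayFunctions leaves the import cone. [difficulty: provable-now] [Aaronson2010 §1,
BernsteinVazirani1997 §8]

TWO-LAYER PLAN. No item-level split is filed: the registered STUB layers of the line leads ARE the
active decompositions (one per node). DegreeOnePrimesEscape ⇐ line dedekind-s3-collision: {S₃
Dedekind relation, embedded S₃-closure, collision transfer, Galois-cubic zero-free (all LANDED),
Stark residue (= the Literature `_holds`), TZ-side additive class PNT (the one remaining analytic
stub), upper/lower shadow + composition (dock, proved)} → crux BY NAME; line
subgroup-orthogonality-escape v4: {X1/X2 log-free zero density in general degree (the debt; tree has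
n ≤ 4 / n ≤ 2), R residue lower bound, per-character deficit and lower PIT from them, Stark} → crux.
PureCubicClassGroupFBQP ⇐ line arakelov-giant-step-cycle: {packing (six-gap), regulator period,
Voronoi chain, admissible fields, regulator (r = 1 period finding), core order canonical,
relation-lattice index, subgroup order (ONE HSP over ℤ^T × ℝ — hardest), generation from
DegreeOnePrimesEscape at n = 3 (LANDED), assembly} → crux BY NAME. STANDING PIVOT (planner,
2026-08-16; trigger: the ∀ n lines end with only general-degree density stubs open, or the FBQP line
lands): move the deciding path to the n = 3 slice — add crux `CubicEscape` (:= the body of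
DegreeOnePrimesEscape at n = 3, subfield clause kept so that `fun h => h 3` is literal), add support
`DegreeOnePrimesEscape → CubicEscape`, restate PureCubicClassGroupFBQP's antecedent to `CubicEscape
→` (its landed stub_generation re-proves with `hEsc` for `hEsc 3`), closes := hT hC h4' h5,
DegreeOnePrimesEscape → support (still crux r5 of ThirdFactorialPincer); payoff: the analytic debt
shrinks from Weiss 4.3 in all degrees to ζ_K log-free density at n = 3 (the L(s,χ≠1) side is PROVED
for n ≤ 4). Not done now: it supersedes the item id of an actively led crux. Off-path earned content
unchanged: the card's P4 (GRH-free AM ∩ coAM verification of pure cubic class numbers) and the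
conditional n = 2 twin (NoSiegelZerosEvenQuadratic → escape count for real quadratic fields).

KILL CRITERIA. (a) The requested precision audit (PRECISION-AUDIT-REQUEST.md on
stmt-QuantumAdvantage-11544) returns `KILL:` — a step of the r = 1 pipeline (Hallgren05 §4–5 / BW88
infrastructure / the ℤ^T × ℝ HSP) needs small-norm generators, GRH or a heuristic that a random
large factor base does not repair → pivot PureCubicClassGroupFBQP to the dark-class-groups move
(adjoin the primes dividing N(α) for random small α, Shor-factored) or close
refuted:PureCubicClassGroupFBQP. (b) DegreeOnePrimesEscape refuted AS TYPED (constant 8, range C, a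
degree/ramification slip) → restate with TZ's exact constants, not a kill; refuted in substance
(positive-proportion escape fails for some no-quadratic-subfield family) → the line is dead, close
refuted:DegreeOnePrimesEscape. (c) A classical PPT (or even L(1/3)) algorithm for h(ℚ(∛m)) kills X →
close refuted:PureCubicClassNumberHard. (d) An unconditional 'Cl(K) ∈ FBQP for cubic K' already in
print → re-grade known, keep the route as the formalisation plan.

NOT DECOMPOSED YET. Everything below the stub layers (lemmas ride with `--supports`); Dedekind's
integral basis for ℚ(∛m) and the Shor factorisation m = ab² (routine, inside stub_cubicFieldFacts /
the classical wrap); the n = 3 pivot items `CubicEscape` / restated FBQP antecedent (see TWO-LAYER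
PLAN: filed only on trigger); the n = 2 conditional twin and the AM ∩ coAM verification (off-path).
The two analytic inputs behind DegreeOnePrimesEscape are NO LONGER 'unstatable': TZ2019 Thm 1.4 is
vendored (commit e03ad0aabfb2) and Stark's consequence is proved; the crux stays their combinatorial
SHADOW on purpose — re-filing it as `(h : TZ-fact) → …` would put an unproved Literature Prop into
the item cone and flip the route unstaffable (obligation-graph §STAFFABILITY).

CHEAPEST FALSIFIER. For the quantum half (the judge's ask): checklist line (f) of
PRECISION-AUDIT-REQUEST.md — read Hallgren2005 §5 and BiasseSong2015/16 §4 and confirm GRH enters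
ONLY through the choice of generators (Bach1990), i.e. the class-group theorems hold 'given
generators of polynomial bit-size' (30 minutes; the 2025 sequel arXiv:2510.02280 Cor. 1 still says
'under GRH' only for generation); then lines (b)(c) against Hallgren2007 §3 (pseudo-injective period
finding) with the six-gap count ≤ 6R/ln 2 + 6. For DegreeOnePrimesEscape: DONE — TZ Thm 1.4's
trivial-character case re-read (p. 3), the conditional proof is kernel-checked, cdisprove gens 1–3
found no finite refutation (C existential) and landed the negative edges
`Negative/WithoutProperFalse` (M ≠ ⊤ load-bearing), `Negative/EscapeCounting`,
`Negative/EscapeSign`. Numerics: j010122 (42 fields ℚ(∛m), m ≤ 79, h ≥ 2, X = 27m²: escape fraction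
≥ 0.368 over all maximal subgroups vs 1/25 needed; generation by deg-1 primes above T random good
primes, T = 8: 8272/8400, T = 30: 8400/8400).

NUMBERS. Bach1990: under GRH primes of norm ≤ 12 log²|D_K| generate Cl(K) (6 log² for quadratic).
TZ2019 Thm 1.4: range x ≥ (D_K Q n_K^(n_K))^c₁, c₁, c₂ absolute effective, exceptional zero β₁ = 1 −
λ₁/log(D_K Q n^n) with λ₁ < 1/8. Stark1974 / MurtyMurty1997 Prop 6.1–Cor 6.2: at most one zero of
ζ_M in σ ≥ 1 − 1/(4 log|d_M|), |t| ≤ 1/(4 log|d_M|); log d_N ≤ [N:ℚ] log d_K ≤ n! log d_K. Classical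
records: Buchmann L_D(1/2) under GRH (Cohen1993 §6.5); unconditional deterministic class number of
cubic fields: exponential (D^(1/4+ε)-type via Shanks-like methods at best). Tree (2026-08-16):
`logFreeDensity_classGroup` proved for n ≤ 4, `logFreeDensity_dedekindZeta₁` for n ≤ 2; Stark
no-quadratic-subfield `_holds` proved; TZ2019 Thm 1.4 vendored (audited faithful). Items: 6 (3
cruxes = auto-crux target X + DegreeOnePrimesEscape + PureCubicClassGroupFBQP; 2 supports PROVED;
assembly PROVED); deciding theorem `closes hT h2 h4 h5` native-OK since rev 4, unchanged by the
2026-08-16 judge-repair (retriage only: why/sources of the two theorem cruxes refreshed, refuter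
precision pass requested).

DEFINITION REQUESTS. None: statements are typed over Mathlib (NumberField.classNumber,
ClassGroup.mk0, Ideal.absNorm, IntermediateField, Nat.primeCounting, IsCoatom) and the tree's FBQP /
RandAlg / RandAlg.IsPolyTime (`IsPPT A id` spelled `A.IsPolyTime id id` since rev 1, `rfl`-equal).
The two Literature facts wanted at open are IN TREE: `…ThornerZaman2019_classPNT_hilbertClassField`
(vendored, UniformClassGroupPNTGeneralDegree.lean) and
`…Stark1974_dedekindZeta_ne_zero_of_noQuadraticSubfield` (PROVED). Remaining analytic debt is
carried as registered STUBS of the lines (log-free zero density in general degree, Weiss1983 Thm 4.3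
/ TZ2019 Thm 3.2; residue lower bound), never as cone facts.

CONE. Revs 1–4 (2026-08-15, gen-1/2 route-repair): `IsPPT` unfolded so that
Cryptography/OneWayFunctions + StatisticalDistance left the import cone; imports :=
[Cryptography/ClassBQP, Complexity/Randomized]. Under the used-constants rule (obligation-graph
§STAFFABILITY) the route is staffable with 0 unproved deps in a cone of 67 project constants
(re-checked 2026-08-16T07:22Z). The earlier operator request to trim Statement.lean's docstring-only
imports (QuantumComplexity.QuantumTuring / .BQP) is moot for staffability and stands only as hygiene
(details in the rev-4 header, git history).

Novelty: Searches (2026-08-15): `lit galaxy search "generate the class group" --star all` (16 rows: crypto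
proceedings, PARI guide, none on
unconditional generation); `lit galaxy search "effective cases of the Brauer-Siegel" --star all` (12
rows → MurtyMurty1997 READ Cor 6.2,
Zykin survey citing Stark for no-quadratic-subfield fields); `lit galaxy search "no quadratic
subfield" --star all` (9 rows, algebra
texts, Cohen GTM138 tables); `lit galaxy search "quantum algorithm for computing S-units" --star
pdf` (0); `lit read arxiv:1803.02823`
(TZ2019 READ pp. 2–4); `lit search` / searchd unavailable this session (rc 75, logged); plus the
card's and its novelty audit's searches
(BiasseSong 2025 arXiv:2510.02280 READ by the auditor: class groups still 'under GRH').
Nearest prior art found: BiasseSong2015 (doi:10.1137/1.9781611974331.ch64) and Hallgren2005 — the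
algorithms, GRH for generation;
ThornerZaman2019 Thm 1.4 — the analytic input, never aimed at an algorithm; route DarkClassGroups
(this hub) — GRH ↦ no-Siegel (i) for
imaginary quadratic fields by random primes at height exp(log²|D|); card
linnik-lights-the-class-group-v2 — the random-large-factor-base
observation, with the trivial-character gap.
Delta: random large factor bases + TZ's K-uniform Chebotarev + Stark's quadratic-subfield criterion
make quantum class-group computation
free of BOTH GRH and any Siegel-zero hypothesis for every fixed-degree family without quadratic
subfields (here: pure cubic fields) — a
combination absent  [refs: 10.1137/1.9781611974331.ch64, 1803.02823, 2510.02280, arxiv:1803.02823, doi:10.1137/1.9781611974331.ch64, MurtyMurty1997, BiasseSong2015, Hallgren2005, ThornerZaman2019]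

Barriers (technique_class: conditional-bridge, quantum-algorithm, analytic-number-theory): - technique_class: conditional-bridge, quantum-algorithm, analytic-number-theory
- Literature.Barriers.QuantumAdvantage.SeparationPrerequisites: NOT evaded — it applies in full to X
(X ∧ PureCubicClassGroupFBQP ⇒ ∃ L ∈ BQP∖BPP ⇒ P ≠ PSPACE); X is hypothesis-type and never staffed
for proof; the bet is that the earned content is the hypothesis-free quantum theorem-target.
- Literature.Barriers.QuantumAdvantage.Relativization: the quantum half is an explicit oracle-free
inclusion (relativizes harmlessly, like Shor); any proof of X must be non-relativizing (h ∈ FPSPACE)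
and is not attempted.
- Literature.Barriers.QuantumAdvantage.Algebrization: same status as Relativization (an algebrizing
proof of X would algebrize BQP ⊄ BPP); not evaded, X is a hypothesis.
- Literature.Barriers.QuantumAdvantage.TotalFunctionSpeedupLimit: consistent — the witness is a
white-box total function (class number), not a black-box query problem; D ≤ O(Q⁴)-type bounds do not
apply.
- Literature.Barriers.QuantumAdvantage.RandomOracleMethod: n/a (no oracle); NaturalProofs /
PPolyOracles / SupremacyTheoremsNonRelativizing: n/a (uniform classes, no sampling inference).
- Negatives index: 3 refuted statements at filing (KummerSector.KsNotFrobenian: zero-polynomial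
Frobenian clause; SeparableFrames two-qubit frame exactness; ShorLocallyDark mixed marginals) — none
is a counting statement over ideal classes or an FBQP claim of this shape; DegreeOnePrimesEscape has
no polynomial-list quantifier to degenerate.

History (route lifecycle, newest last):
- 2026-08-15T18:44:17Z · rev 1: restated PureCubicClassNumberHard (stmt-QuantumAdvantage-11542) — route-repair (cone) 1/2: target restated 1:1 — abbreviation IsPPT A id unfolded to A.IsPolyTime id id (rfl-equal, DefEqCheck.lean rc 0) so the OneWayFunctions i (planner-rrepair-QuantumAdvantage-LinnikCubicCl-72314ac8-0)
- 2026-08-15T18:54:35Z · rev 2: restated Assembly (stmt-QuantumAdvantage-11546) — route-repair (cone) 2b/4: Assembly restated over BitwiseSearchToDecision (the gate does not allow dropping the assembly item); same chain DegreeOnePrimesEscape (planner-rrepair-QuantumAdvantage-LinnikCubicCl-72314ac8-0)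
- 2026-08-15T18:58:07Z · rev 4: dropped SearchToDecision — route-repair (cone): IsPPT unfolded to RandAlg.IsPolyTime so Cryptography/OneWayFunctions (+StatisticalDistance: 4 open OWF conjectures + undischarged IsStatist (planner-rrepair-QuantumAdvantage-LinnikCubicCl-72314ac8-0)
- 2026-08-16T04:15:00Z · AUTO-CRUX (backfill): PureCubicClassNumberHard — hypotheses of the deciding theorem that nothing in the route derives are cruxes (operator:999:1085951)
- 2026-08-26T15:00:32Z · DORMANT — reconciler: no traction for 6.5 d (last activity item-evidence-added at 2026-08-20T02:36:12Z); parked, not closed — `ledger route dormant route-QuantumAdvantage (operator:999:3797297)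

sub-problem: QuantumAdvantage · status: dormant · opened planner-plancard-QuantumAdvantage-QuantumAdva-f29a38d5-0 2026-08-15T18:22:36Z · rev 7 · ledger route-QuantumAdvantage-LinnikCubicClassGroups
GENERATED by the gate from the ledger (D-0016/17). Provers cite these decls: `theorem foo : Summit.QuantumAdvantage.QuantumAdvantage.Theses.LinnikCubicClassGroups.<Decl> := …` in Summits/QuantumAdvantage/QuantumAdvantage/Theorems/<Name>.lean.
-/

namespace Summit.QuantumAdvantage.QuantumAdvantage.Theses.LinnikCubicClassGroups

open scoped BigOperators Topology Manifold Classical MeasureTheory ProbabilityTheory Matrix InnerProductSpace ComplexConjugate ContinuousMap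
open Filter Set Function TopologicalSpace MeasureTheory

attribute [summit_statement] _root_.QuantumAdvantage

open Literature.QuantumAdvantage

-- earlier PureCubicClassNumberHard (stmt-QuantumAdvantage-11542, replaced 2026-08-15T18:44:17Z -> stmt-QuantumAdvantage-11826): retired by None — ¬ ∃ A : Literature.Computability.Complexity.RandAlg (List Bool) (List Bool), Literature.Computability.Cryptography.IsPPT A id ∧ ∀ (x : List Bool) (K : Type) [Field K] [NumberField K], Module.finrank ℚ K = 3 → (∀ r : ℕ, r ^ 3 ≠ Computability.decodeNat x) → 
/-- item stmt-QuantumAdvantage-11826 · crux (kind.auto-crux: conjecture-grade) · rank 0 · open · by planner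
why it might fail: Hypothesis-type: false iff a PPT algorithm outputs h(ℚ(∛m)) (= its low 2|x|+8 bits) w.p. ≥2/3 for all non-cube m — nothing structural forbids it (best classical: Buchmann L(1/2) under GRH); true ⇒ FBPP-vs-PSPACE-type separation (SeparationPrerequisites): unprovable today, never staffed.
sources: Cohen1993 §6.5, Bach1990, BiasseSong2015, Hallgren2005, Literature.Barriers.QuantumAdvantage.SeparationPrerequisites
[target] X (hypothesis-type, never staffed for proof): no PPT algorithm A outputs with probability ≥
2/3, for every bit string x with m = decodeNat x not a perfect cube and every number field K of
degree 3 containing a cube root of m (all ≅ ℚ(∛m)), the list of the 2|x|+8 low bits of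
NumberField.classNumber K. [difficulty: open-problem] -/
@[route_item "route-QuantumAdvantage-LinnikCubicClassGroups", crux]
def PureCubicClassNumberHard : Prop :=
  ¬ ∃ A : Literature.Computability.Complexity.RandAlg (List Bool) (List Bool), A.IsPolyTime id id ∧ ∀ (x : List Bool) (K : Type) [Field K] [NumberField K], Module.finrank ℚ K = 3 → (∀ r : ℕ, r ^ 3 ≠ Computability.decodeNat x) → (∃ α : K, α ^ 3 = (Computability.decodeNat x : K)) → (2 : ℝ) / 3 ≤ A.pr id x {List.ofFn (fun i : Fin (2 * x.length + 8) => (NumberField.classNumber K).testBit i.val)}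

/-- item stmt-QuantumAdvantage-11543 · crux · rank 2 · closed · proved by Summit.QuantumAdvantage.QuantumAdvantage.Theorems.DegreeOnePrimesEscape.degreeOnePrimesEscape_proof @ 26269d93e3f1 (prover) · by planner
why it might fail: Conditionally PROVED ×2 (TZ2019 Thm1.4 fact → crux, rc0 std axioms; Stark input PROVED in Literature): false only with the printed Hilbert-class-field PNT. Live risk is FORMAL: ∀n needs log-free zero density in every degree (tree: L(s,χ≠1) n≤4, ζ_K n≤2) — the route consumes n=3 only (h4 h2).
sources: arXiv:1803.02823 Thm 1.4 + Thm 3.2 (ThornerZaman2019; vendored: Literature.NumberTheory.LFunctions.NumberField.ThornerZaman2019_classPNT_hilbertClassField, audited faithful Disproof §11), Stark1974 Thm 3 = MurtyMurty1997 Cor 6.2 (PROVED: Literature.NumberTheory.LFunctions.NumberField.Stark1974_dedekindZeta_ne_zero_of_noQuadraticSubfield_holds), Weiss1983 Thm 4.3 (doi:10.1515/crll.1983.338.56) — general-degree log-free density; tree: logFreeDensity_classGroup (n≤4), logFreeDensity_dedekindZeta₁ (n≤2), arXiv:2412.01802 Cor 4 (Thorner–Zhang 2024; second printed source of the h-free polynomial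 range), Cruxes/DegreeOnePrimesEscape/IdeatorSketchR1I3.lean OneSidedShadows.degreeOnePrimesEscape_of_TZ_Stark; Lines/subgroup-orthogonality-escape.lean cruxFromTZStark_holds; Lines/dedekind_s3_collision.lean (stubs 1–4 landed)
[crux] card K1 corrected (Linnik–Stark escape count). For every n there is C = C(n) such that for
every number field K of degree n with NO quadratic subfield, every x ≥ |D_K|^C and every proper
subgroup M of Cl(O_K): π(x) ≤ 8 · #{P prime of O_K : N(P) prime, N(P) ≤ x, [P] ∉ M}. Proof on paper:
TZ2019 Thm 1.4 with F = K, L = Hilbert class field, H = G = Cl(K), Q = 1; Stark: ζ_K(σ) ≠ 0 on [1 −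
1/(4·n!·log|D_K|), 1) since log d_N ≤ n! log d_K and K ⊉ quadratic field, so a TZ-exceptional χ₁ is
either absent, or trivial with λ₁ ≥ 1/(4 n!) (depletion ≤ e^(−2) once C ≥ 8 n!), or a nontrivial
quadratic character with kernel K₁ of index 2 — then classes outside M ∪ K₁ number ≥ h/4 and each
holds ≥ (1−o(1)) Li(x)/h primes (sign −χ₁(C) = +1); degree ≥ 2 primes are O(n√x). [difficulty: L] -/
@[route_item "route-QuantumAdvantage-LinnikCubicClassGroups", crux]
def DegreeOnePrimesEscape : Prop :=
  ∀ n : ℕ, ∃ C : ℕ, ∀ (K : Type) [Field K] [NumberField K], Module.finrank ℚ K = n → (∀ F : IntermediateField ℚ K, Module.finrank ℚ F ≠ 2) → ∀ x : ℕ, |NumberField.discr K| ^ C ≤ (x : ℤ) → ∀ M : Subgroup (ClassGroup (NumberField.RingOfIntegers K)), M ≠ ⊤ → Nat.primeCounting x ≤ 8 * Set.ncard {P : Ideal (NumberField.RingOfIntegers K) | P.IsPrime ∧ (Ideal.absNorm P).Prime ∧ Ideal.absNorm P ≤ x ∧ ∃ hP : P ∈ nonZeroDivisors (Ideal (NumberField.RingOfIntegers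 K)), ClassGroup.mk0 ⟨P, hP⟩ ∉ M}

-- `DegreeOnePrimesEscape` holds: proved by `Summit.QuantumAdvantage.QuantumAdvantage.Theorems.DegreeOnePrimesEscape.degreeOnePrimesEscape_proof` @ 26269d93e3f1 (its module imports this route file, so no `_holds` link can be stated here).

/-- item stmt-QuantumAdvantage-11544 · crux · rank 3 · closed · proved by Summit.QuantumAdvantage.QuantumAdvantage.Theorems.LinnikCubicClassGroups.PureCubicClassGroupFBQP_proof @ 3d54da19578f (prover) · by planner
why it might fail: Unit rank 1 (K∋∛m): the line is Buchmann–Williams/Hallgren infrastructure period finding + ONE HSP over ℤ^T×ℝ, no EHKS14. Breaks if, with T=O(log²D) generators of norm ≤D^C, the discretised distance map is not O(1/N)-pseudo-injective, wrap-around needs small norms, or success <2/3 on some x.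
sources: Hallgren2005 (doi:10.1145/1060590.1060660) §4–5: unit group / class group given generators, constant degree (GRH only for choosing generators), Hallgren2007 J.ACM 54(1) (doi:10.1145/1206035.1206039): period finding over ℝ, pseudo-injectivity — the r=1 precision template, SchmidtVollmer2005 STOC (doi:10.1145/1060590.1060661): independent precision analysis, unit group, BuchmannWilliams1988 Math.Comp.50:569–579 (doi:10.2307/2008625): infrastructure of unit-rank-one fields, giant steps, EHKS14 (doi:10.1145/2591796.2591860) §6 — continuous HSP, needed only for r>1 (contrast); BiasseSong2015 (doi:10.1137/1.9781611974331.ch64) §4, Cruxes/PureCubicClassGroupFBQP/Lines/arakelov_giant_step_cycle.lean: stub_subgroupOrder (S5b, hardest), stub_regulator (S3b), stub_assembly; DREFUTE-arakelov-giant-step-cycle.md; numerics j010122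
[crux] card K3 at n = 3 (theorem-target, the quantum half). Assuming DegreeOnePrimesEscape (and
using the provable-now lemma RandomSamplesGenerate), there is f ∈ FBQP with |f x| = 2|x|+8 and f x =
the low bits of h(K) for every degree-3 number field K containing a cube root of the non-cube m =
decodeNat x. Algorithm: Shor-factor m = ab² and write Dedekind's integral basis of ℚ(∛m) (Cohen1993
§6.4); draw T = O(log |D_K|) uniform random primes q ≤ |D_K|^C(3), factor qO_K, keep a random
degree-one factor (escape probability ≥ 1/(8·9) per draw for every maximal subgroup by
DegreeOnePrimesEscape and #{deg-1 primes ≤ x} ≤ 3π(x)); by RandomSamplesGenerate (#subgroups of Cl ≤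
h^(log₂ h)) the T primes generate Cl(K) w.p. ≥ 1 − 1/|D_K|; run the Hallgren2005 / EHKS 2014 /
BiasseSong2015 continuous hidden-subgroup computation of the relation lattice Λ ⊂ ℤ^T × ℝ^(r) of
these primes (no smoothness, no verification); h = det of the ℤ^T-projection; output 2|x|+8 bits (h
≪ √|D_K| log²|D_K| < 2^(2|x|+8)). [deps: DegreeOnePrimesEscape] [difficulty: XL] -/
@[route_item "route-QuantumAdvantage-LinnikCubicClassGroups", crux]
def PureCubicClassGroupFBQP : Prop :=
  DegreeOnePrimesEscape → ∃ f : List Bool → List Bool, f ∈ Literature.Computability.Cryptography.FBQP ∧ (∀ x, (f x).length = 2 * x.length + 8) ∧ ∀ (x : List Bool) (K : Type) [Field K] [NumberField K], Module.finrank ℚ K = 3 → (∀ r : ℕ, r ^ 3 ≠ Computability.decodeNat x) → (∃ α : K, α ^ 3 = (Computability.decodeNat x : K)) → f x = List.ofFn (fun i : Fin (2 * x.length + 8) => (NumberField.classNumber K).testBit i.val)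

-- `PureCubicClassGroupFBQP` holds: proved by `Summit.QuantumAdvantage.QuantumAdvantage.Theorems.LinnikCubicClassGroups.PureCubicClassGroupFBQP_proof` @ 3d54da19578f (its module imports this route file, so no `_holds` link can be stated here).

/-- item stmt-QuantumAdvantage-11545 · support · rank 9 · closed · proved by Summit.QuantumAdvantage.QuantumAdvantage.Theorems.LinnikCubicClassGroups.randomSamplesGenerate_proof @ 34fd3613e614 (prover) · by planner
sources: CheungMosca2001 §3, Hallgren2005 §4, Mathlib IsCoatom / Subgroup.closure (folklore union bound)
[support] card P1/K2 abstracted (provable now): G a finite group, s : Ω → G a finite sample space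
such that for every maximal subgroup M at least δ|Ω| sample points fall outside M (0 ≤ δ ≤ 1); then
among the |Ω|^T sequences of T samples at most #Sub(G)·(1−δ)^T·|Ω|^T generate a proper subgroup (a
proper subgroup of a finite group lies in a coatom; union bound over coatoms ≤ #subgroups; for the
class group #Sub ≤ h^(log₂ h), so T = O((log² h + log(1/ε))/δ) suffices). [difficulty: provable-now] -/
@[route_item "route-QuantumAdvantage-LinnikCubicClassGroups"]
def RandomSamplesGenerate : Prop :=
  ∀ (G : Type) [Group G] [Fintype G] (Ω : Type) [Fintype Ω] (s : Ω → G) (δ : ℝ) (T : ℕ), 0 ≤ δ → δ ≤ 1 → (∀ M : Subgroup G, IsCoatom M → δ * (Fintype.card Ω : ℝ) ≤ ((Finset.univ.filter fun ω : Ω => s ω ∉ M).card : ℝ)) → ((Finset.univ.filter fun v : Fin T → Ω => Subgroup.closure (Set.range (s ∘ v)) ≠ ⊤).card : ℝ) ≤ (Nat.card (Subgroup G) : ℝ) * (1 - δ) ^ T * (Fintype.card Ω : ℝ) ^ T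

-- `RandomSamplesGenerate` holds: proved by `Summit.QuantumAdvantage.QuantumAdvantage.Theorems.LinnikCubicClassGroups.randomSamplesGenerate_proof` @ 34fd3613e614 (its module imports this route file, so no `_holds` link can be stated here).

/-- item stmt-QuantumAdvantage-12110 · support · rank 9 · closed · proved by Summit.QuantumAdvantage.QuantumAdvantage.Theorems.LinnikCubicClassGroups.BitwiseSearchToDecision_proof (prover) · by planner
sources: Aaronson2010 §1, BernsteinVazirani1997 §8
[support] Bitwise search-to-decision: if f has exactly polynomial output length and f ∈ FBQP, each
bit language {(x,i) : (f x)_i = 1} is in BQP (read wire i of the FBQP family), hence in BPP under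
the collapse BQP ⊆ BPP; amplify each to error < 1/(3 p(|x|)) and concatenate, giving a PPT algorithm
A with Pr[A(x) = f x] ≥ 2/3. Same proposition as the shared stmt-QuantumAdvantage-0235 (routes
Shor/DarkClassGroups) with the abbreviation `IsPPT A id` unfolded to `A.IsPolyTime id id`
(`rfl`-equal: a proof of either is a proof of the other verbatim) so that this route does not import
Cryptography/OneWayFunctions. [difficulty: provable-now] [Aaronson2010 §1 (FBQP);
BernsteinVazirani1997 §8; folklore] -/
@[route_item "route-QuantumAdvantage-LinnikCubicClassGroups", crux]
def BitwiseSearchToDecision : Prop :=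
  ∀ f : List Bool → List Bool, (∃ p : Polynomial ℕ, ∀ x, (f x).length = p.eval x.length) → f ∈ Literature.Computability.Cryptography.FBQP → Literature.Computability.Cryptography.BQP ⊆ Literature.Computability.Complexity.BPP → ∃ A : Literature.Computability.Complexity.RandAlg (List Bool) (List Bool), A.IsPolyTime id id ∧ ∀ x, 2 / 3 ≤ A.pr id x {f x}

-- `BitwiseSearchToDecision` holds: proved by `Summit.QuantumAdvantage.QuantumAdvantage.Theorems.LinnikCubicClassGroups.BitwiseSearchToDecision_proof` (its module imports this route file, so no `_holds` link can be stated here).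

-- earlier Assembly (stmt-QuantumAdvantage-11546, replaced 2026-08-15T18:54:35Z -> stmt-QuantumAdvantage-12412): retired by None — DegreeOnePrimesEscape → PureCubicClassGroupFBQP → SearchToDecision → PureCubicClassNumberHard → QuantumAdvantage
/-- item stmt-QuantumAdvantage-12412 · assembly · rank 1 · closed · proved by Summit.QuantumAdvantage.QuantumAdvantage.Theorems.LinnikCubicClassGroups.Assembly_proof (prover) · by planner
sources: BernsteinVazirani1997 §8, Aaronson2010 §1
[assembly] DegreeOnePrimesEscape → PureCubicClassGroupFBQP → SearchToDecision →
PureCubicClassNumberHard → QuantumAdvantage. -/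
@[route_item "route-QuantumAdvantage-LinnikCubicClassGroups"]
def Assembly : Prop :=
  DegreeOnePrimesEscape → PureCubicClassGroupFBQP → BitwiseSearchToDecision → PureCubicClassNumberHard → QuantumAdvantage

-- `Assembly` holds: proved by `Summit.QuantumAdvantage.QuantumAdvantage.Theorems.LinnikCubicClassGroups.Assembly_proof` (its module imports this route file, so no `_holds` link can be stated here).

/-! D-0027 §2.1 — DECIDING THEOREM (planner-authored via `route open/edit --closes-file`; by planner-rrepair-QuantumAdvantage-LinnikCubicCl-72314ac8-0 2026-08-15T18:58:07Z):
its hypotheses are this route's items and its conclusion the sub-problem Statement (glue_lint), and it elaborates with this file. -/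

/-- DECIDING THEOREM (D-0027 §2.1). Pure logic: `PureCubicClassGroupFBQP` applied to the crux
`DegreeOnePrimesEscape` yields `f ∈ FBQP` of output length `2|x|+8`
agreeing with the class-number bits of `ℚ(∛m)` on every valid input; if the summit failed, `BQP ⊆ BPP` (classically),
and `BitwiseSearchToDecision` (polynomial `2X+8`) would give a PPT algorithm computing `f`, hence the class-number bits,
contradicting the hypothesis-type target `PureCubicClassNumberHard`. (Route-repair rev 2: `BitwiseSearchToDecision`
is the former shared `SearchToDecision` with `IsPPT` unfolded; the proof is unchanged.) -/
@[closes "route-QuantumAdvantage-LinnikCubicClassGroups"] theorem closes (hT : PureCubicClassNumberHard) (h2 : DegreeOnePrimesEscape)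
    (h4 : PureCubicClassGroupFBQP) (h5 : BitwiseSearchToDecision) : _root_.QuantumAdvantage := by
  by_contra hQA
  have hsub : Literature.Computability.Cryptography.BQP ⊆ Literature.Computability.Complexity.BPP :=
    fun L hL => Classical.by_contradiction fun hL' =>
      hQA (show _root_.QuantumAdvantage from ⟨L, hL, hL'⟩)
  obtain ⟨f, hf, hlen, hval⟩ := h4 h2
  obtain ⟨A, hA, hAf⟩ := h5 f ⟨2 * Polynomial.X + 8, fun x => by simp [hlen]⟩ hf hsub
  apply hT
  refine ⟨A, hA, ?_⟩
  intro x K _ _ hdeg hnc hα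
  rw [← hval x K hdeg hnc hα]
  exact hAf x

end Summit.QuantumAdvantage.QuantumAdvantage.Theses.LinnikCubicClassGroups
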